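/-
Copyright: statement-level skeleton of a published paper (lit-balaban cell, Phase-2 proof seat p19, gen 4). No claims beyond
what the kernel checks below.
-/
import Mathlib
import Literature.MathematicalPhysics.QuantumFieldTheory.Balaban1983to89.B3AmpIBPBounds

/-!
# B3 — T. Bałaban, *(Higgs)₂,₃ quantum fields in a finite volume. III. Renormalization*, CMP **88** (1983) 411–445
[Balaban1983Higgs3] — Proposition 2.1 pp. 424–426 WITH THE (2.4) EXCEPTION, assembled for ONE amplitude: (1.33) for the sum
with fixed ordering l̃ and for the total amplitude when the components of the `G_i` have positive degree OR are (2.4)-blocks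

statement-level skeleton of published theorems with citation tags; proofs where landed; nothing here is a claim about
the Yang–Mills mass gap

PDF held: `paper:balaban1983-higgs-2-3-quantum-fields-finite-volume` (journal page = PDF page + 410); displays and sentences
of pp. 420–421, 424–428 read on the ×2 renders `pub-balaban/b2b-balaban-ref1/pages/1983-cmp88-higgs23-III/
1983-cmp88-higgs23-III-p010, p011, p014 … p018-x2.png`.

Part of the Phase-2 work on SKELETON rows **B3.Prop2.1 / B3.Prop2.2** (unit `lit-balaban-p19` gen 4, HOME
`run/shared/lean/pub/lit-balaban/`): the last file of the (2.4) EXCEPTION of Proposition 2.1 (`B3LatticeIBP` → `B3AmpIBP` →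
`B3AmpIBPClosed` → `B3AmpIBPAll` → `B3IBPSites` → `B3IBPDegrees`, `B3IBPKernelBounds` → `B3AmpIBPBounds` → this file →
`B3Prop21Except24`), completing
`B3Prop21Instance` (gen 3: one count datum, `Is24 := False`) and `B3Prop21Uniform` (gen 4: O(1) uniform, `Is24 := False`).

WHAT IS REPRODUCED.  Proposition 2.1 p. 424 [PDF 14], verbatim: *"Let G be a connected graph such that its each connected
subgraph, with the possible exception of the subgraphs (2.4), has a positive degree. Then we define G_ren = {G} and
Proposition 1 holds in this case."*, with its printed proof pp. 424–428: (2.6)/(2.7) (decomposition of the propagators, sum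
over the orderings l̃ — `B3Prop21Model`, r15's `B3.display27`), the integration by parts (2.8)/(2.9) at the subgraphs (2.4)
along each ordering (*"this way we represent G′ as a sum of graphs {G′∗} … for each graph G′∗ the subgraphs G₁, G₂, …, G_m =
G′∗ defined as previously have positive degrees"* — `B3AmpIBPAll`, `B3IBPDegrees`, `B3AmpIBPBounds`), the first estimate (2.13)
(`B3Ineq213Proof`) and (2.15) (`B3Ineq215Proof`) for each `G′∗`, with *"O(1) depending on n̄ and δ₁ only"* (`B3Prop21Uniform`).
KERNEL-CHECKED HERE, for ONE IBP-ready amplitude `A : IBPAmp G` (`B3AmpIBPBounds`): relabeling along an ordering keeps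
IBP-readiness (`IBPAmp.relabel`); the number of graphs `G′∗` along an ordering is `≤ (m+1)^m` (`card_choices_le`); **(1.33) for
the sum with fixed ordering l̃** when every component of the `G_i` along l̃ has positive degree OR is a (2.4)-block
(`sum_abs_E_le_ordering`: `Σ_{j∈J(l̃)} |E(G(j))| ≤ #{G′∗}·(Π_l C_l)(1+e^{δ₁})^{2m}·unifConst215(d,L,m,δ₁)·cD^m·pref` — (2.7), the
integration by parts at the sites of l̃ (`IBPAmp.E_eq_sum_terms`), then (2.13) (`Amp.abs_E_le`) and (2.15)
(`Model.ineq215_of_pos`, all blocks of each `G′∗` positive by `B3IBPDegrees.pos_moveCounts`, constant uniform by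
`B3Prop21Uniform.const215_le_unifConst215`) term by term); and summed over the `m!` orderings, **(1.33) for the total amplitude**
(`abs_Etot_le_except24`).  The family statement `B3Prop1.Prop21` is inhabited in `B3Prop21Except24`.
-/

open Finset

namespace Literature.MathematicalPhysics.QuantumFieldTheory.Balaban1983to89.B3Ineq213

open B3Ineq215 B3Sect2FirstEstimate B3Prop1

variable {V : Type} [Fintype V] [DecidableEq V] {m : ℕ}

/-! ## Relabeling an IBP-ready amplitude along an ordering -/

namespace IBPAmp

variable {G : Counts V m} (A : IBPAmp G)

/-- The IBP-ready amplitude with its lines renumbered along the ordering l̃ = σ (`Amp.relabel` plus the readiness data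
carried along). [cite: Balaban1983Higgs3, (2.7) p.425] -/
noncomputable def relabel (σ : Equiv.Perm (Fin m)) : IBPAmp (relabelCounts G σ) where
  toAmp := A.toAmp.relabel σ
  dir := A.dir
  Kb := fun i => A.Kb (σ i)
  cD := A.cD
  one_le_cD := A.one_le_cD
  K_eq := fun i hne hd t x y => A.K_eq (σ i) hne hd t x y
  Kb_le := fun i hne hd => A.Kb_le (σ i) hne hd
  u_face := fun i hne hd => A.u_face (σ i) hne hd
  du_le := fun i hne hd x => A.du_le (σ i) hne hd x
  KdX_le := fun i μ => A.KdX_le (σ i) μ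
  KdY_le := fun i ν => A.KdY_le (σ i) ν
  KdXY_le := fun i μ ν => A.KdXY_le (σ i) μ ν

/-- Relabeling does not change the prefactor (the amplitude and the product of the kernel constants are unchanged too:
`B3Prop21Model.Amp.E_relabel`, `Amp.prod_C_relabel`, used below through `toAmp`). [cite: Balaban1983Higgs3, (2.7) p.425] -/
theorem relabel_pref (σ : Equiv.Perm (Fin m)) : (A.relabel σ).toAmp.pref = A.toAmp.pref := rfl

/-! ## The number of terms `G′∗` -/

omit [Fintype V] in
/-- The number of graphs `G′∗` along an ordering is at most `(m+1)^m` (at most `m + 1` options per line).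
[cite: Balaban1983Higgs3, (2.9) p.425] -/
theorem card_choices_le (src tgt : Fin m → V) (S : Finset (Fin m)) : (choices src tgt S).card ≤ (m + 1) ^ m := by
  classical
  unfold choices
  rw [Fintype.card_piFinset]
  calc ∏ l, (opts src tgt S l).card ≤ ∏ _l : Fin m, (m + 1) := by
        refine prod_le_prod' fun l _ => ?_
        unfold opts
        split_ifs
        · rw [Finset.card_insertNone]
          have : (touching src tgt (src l) l).card ≤ m := (card_le_univ _).trans (by simp)
          omega
        · simp
    _ = (m + 1) ^ m := by rw [prod_const, card_univ, Fintype.card_fin]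

/-! ## (1.33) for the sum with fixed ordering, the (2.4)-blocks admitted -/

/-- **(1.33) for the sum with fixed ordering l̃, with the (2.4) exception**: if every component of the subgraphs `G_1 ⊂ … ⊂
G_m` along σ has positive degree OR is a (2.4)-block, then `Σ_{j∈J(l̃)} |E(G(j), {□(v)}, Φ′, A)| ≤ #{G′∗} · (Π_l C_l)(1+e^{δ₁})^{2m} ·
unifConst215(d, L, m, δ₁) · cD^m · pref` — (2.7), then (2.8)/(2.9) at the sites (`E_eq_sum_terms`), then (2.13) and (2.15) for
each term `G′∗` (all of whose blocks have positive degree, `pos_moveCounts`). [cite: Balaban1983Higgs3, Prop. 2.1 p.426] -/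
theorem sum_abs_E_le_ordering (𝒜 : B3.Assignment m A.k) (σ : Equiv.Perm (Fin m))
    (hyp : ∀ i, i ≤ m → ∀ b ∈ (relabelCounts G σ).toModel.reps i, (relabelCounts G σ).toModel.Nontriv i b →
      Is24Block (relabelCounts G σ) i b ∨ 0 < (relabelCounts G σ).toModel.D i b) :
    ∑ j ∈ 𝒜.J σ, |A.E (fun l => ((j l : Fin A.k) : ℕ))|
      ≤ ((choices (relabelCounts G σ).src (relabelCounts G σ).tgt (sites (relabelCounts G σ))).card : ℝ)
        * (((∏ l, A.C l) * ((1 + Esh G.toModel) ^ 2) ^ m) * unifConst215 G.d G.L m G.δ₁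
          * (A.cD ^ m * A.toAmp.pref)) := by
  classical
  set Gs := relabelCounts G σ with hGs
  set As : IBPAmp Gs := A.relabel σ with hAs
  set S := sites Gs with hSdef
  have hSsub : S ⊆ sites Gs := subset_refl _
  -- the reading of `j ∈ J(l̃)` along σ is a member of `Mon m k`, injectively
  have hmem : ∀ j ∈ 𝒜.J σ, (fun i => ((j (σ i) : Fin A.k) : ℕ)) ∈ Model.Mon m A.k :=
    fun j hj => Model.mem_Mon_of_orderedAlong (𝒜.ordered σ j hj)
  have hinj : Set.InjOn (fun (j : Fin m → Fin A.k) (i : Fin m) => ((j (σ i) : Fin A.k) : ℕ)) ↑(𝒜.J σ) := by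
    intro j _ j' _ h
    funext l
    have e := congrFun h (σ.symm l)
    simp only [Equiv.apply_symm_apply] at e
    exact Fin.ext e
  -- each term: (2.13) termwise and (2.15), all blocks positive
  have hterm : ∀ c : {c // c ∈ choices Gs.src Gs.tgt S},
      ∑ j' ∈ Model.Mon m A.k, |(As.term hSsub c.2).E j'|
        ≤ ((∏ l, A.C l) * ((1 + Esh G.toModel) ^ 2) ^ m) * unifConst215 G.d G.L m G.δ₁ * (A.cD ^ m * A.toAmp.pref) := by
    intro c
    set T := As.term hSsub c.2 with hT
    have hpos := pos_moveCounts Gs c.2 hyp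
    have hTk : T.k = A.k := rfl
    have h213 : ∀ j' ∈ Model.Mon m A.k, |T.E j'| ≤ (∏ q, T.C q) * T.pref * (moveCounts Gs S c.1).toModel.W 0 A.k j' T.box := by
      intro j' hj'
      exact T.abs_E_le hj'
    have hW : ∑ j' ∈ Model.Mon m A.k, (moveCounts Gs S c.1).toModel.W 0 A.k j' T.box
        ≤ (moveCounts Gs S c.1).toModel.const215 := (moveCounts Gs S c.1).toModel.ineq215_of_pos hpos A.k T.box
    have hconst : (moveCounts Gs S c.1).toModel.const215 ≤ unifConst215 G.d G.L m G.δ₁ :=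
      const215_le_unifConst215 (moveCounts Gs S c.1) hpos
    have hC : ∏ q, T.C q = (∏ l, A.C l) * ((1 + Esh G.toModel) ^ 2) ^ m := by
      rw [hT, As.term_prod_C hSsub c.2, ← A.toAmp.prod_C_relabel σ]
      rfl
    have hpref : T.pref ≤ A.cD ^ m * A.toAmp.pref := As.term_pref_le hSsub c.2
    have hC0 : 0 ≤ ∏ q, T.C q := prod_nonneg fun q _ => T.C_nonneg q
    have hP0 : 0 ≤ T.pref := T.pref_nonneg
    have hU0 : 0 ≤ unifConst215 G.d G.L m G.δ₁ := (unifConst215_pos G.d_pos G.two_le_L m G.δ₁_pos).le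
    calc ∑ j' ∈ Model.Mon m A.k, |T.E j'|
        ≤ ∑ j' ∈ Model.Mon m A.k, (∏ q, T.C q) * T.pref * (moveCounts Gs S c.1).toModel.W 0 A.k j' T.box :=
          sum_le_sum h213
      _ = (∏ q, T.C q) * T.pref * ∑ j' ∈ Model.Mon m A.k, (moveCounts Gs S c.1).toModel.W 0 A.k j' T.box := by
          rw [mul_sum]
      _ ≤ (∏ q, T.C q) * T.pref * unifConst215 G.d G.L m G.δ₁ :=
          mul_le_mul_of_nonneg_left (hW.trans hconst) (mul_nonneg hC0 hP0)
      _ ≤ (∏ q, T.C q) * (A.cD ^ m * A.toAmp.pref) * unifConst215 G.d G.L m G.δ₁ :=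
          mul_le_mul_of_nonneg_right (mul_le_mul_of_nonneg_left hpref hC0) hU0
      _ = _ := by rw [hC]; ring
  -- assemble
  calc ∑ j ∈ 𝒜.J σ, |A.E (fun l => ((j l : Fin A.k) : ℕ))|
      = ∑ j ∈ 𝒜.J σ, |As.E (fun i => ((j (σ i) : Fin A.k) : ℕ))| := by
        refine sum_congr rfl fun j _ => ?_
        rw [← A.toAmp.E_relabel σ (fun l => ((j l : Fin A.k) : ℕ))]
        rfl
    _ ≤ ∑ j ∈ 𝒜.J σ, ∑ c ∈ (choices Gs.src Gs.tgt S).attach, |(As.term hSsub c.2).E (fun i => ((j (σ i) : Fin A.k) : ℕ))| := by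
        refine sum_le_sum fun j _ => ?_
        rw [As.E_eq_sum_terms hSsub]
        exact abs_sum_le_sum_abs _ _
    _ = ∑ c ∈ (choices Gs.src Gs.tgt S).attach, ∑ j ∈ 𝒜.J σ, |(As.term hSsub c.2).E (fun i => ((j (σ i) : Fin A.k) : ℕ))| :=
        sum_comm
    _ ≤ ∑ c ∈ (choices Gs.src Gs.tgt S).attach, ∑ j' ∈ Model.Mon m A.k, |(As.term hSsub c.2).E j'| := by
        refine sum_le_sum fun c _ => ?_
        calc ∑ j ∈ 𝒜.J σ, |(As.term hSsub c.2).E (fun i => ((j (σ i) : Fin A.k) : ℕ))|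
            = ∑ j' ∈ (𝒜.J σ).image (fun (j : Fin m → Fin A.k) (i : Fin m) => ((j (σ i) : Fin A.k) : ℕ)),
                |(As.term hSsub c.2).E j'| := by rw [sum_image hinj]
          _ ≤ ∑ j' ∈ Model.Mon m A.k, |(As.term hSsub c.2).E j'| := by
              apply sum_le_sum_of_subset_of_nonneg
              · intro j' hj'
                obtain ⟨j, hj, rfl⟩ := mem_image.1 hj'
                exact hmem j hj
              · intro j' _ _
                exact abs_nonneg _
    _ ≤ ∑ _c ∈ (choices Gs.src Gs.tgt S).attach,
          ((∏ l, A.C l) * ((1 + Esh G.toModel) ^ 2) ^ m) * unifConst215 G.d G.L m G.δ₁ * (A.cD ^ m * A.toAmp.pref) :=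
        sum_le_sum fun c _ => hterm c
    _ = _ := by rw [sum_const, card_attach, nsmul_eq_mul]

/-- **(1.33) for the total amplitude, with the (2.4) exception** (the sum over the orderings of `sum_abs_E_le_ordering`):
`|E(G′, {□(v)}, Φ′, A)| ≤ m!·(m+1)^m·(Π_l C_l)(1+e^{δ₁})^{2m}·unifConst215·cD^m·pref`. [cite: Balaban1983Higgs3, Prop. 2.1 p.424] -/
theorem abs_Etot_le_except24
    (hyp : ∀ σ : Equiv.Perm (Fin m), ∀ i, i ≤ m → ∀ b ∈ (relabelCounts G σ).toModel.reps i,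
      (relabelCounts G σ).toModel.Nontriv i b → Is24Block (relabelCounts G σ) i b ∨ 0 < (relabelCounts G σ).toModel.D i b) :
    |A.toAmp.Etot| ≤ (m.factorial : ℝ) * ((m + 1) ^ m : ℕ)
      * (((∏ l, A.C l) * ((1 + Esh G.toModel) ^ 2) ^ m) * unifConst215 G.d G.L m G.δ₁ * (A.cD ^ m * A.toAmp.pref)) := by
  classical
  set B := ((∏ l, A.C l) * ((1 + Esh G.toModel) ^ 2) ^ m) * unifConst215 G.d G.L m G.δ₁ * (A.cD ^ m * A.toAmp.pref)
    with hB
  have hB0 : 0 ≤ B := by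
    rw [hB]
    have h1 : 0 ≤ ∏ l, A.C l := prod_nonneg fun l _ => A.C_nonneg l
    have h2 : 0 ≤ unifConst215 G.d G.L m G.δ₁ := (unifConst215_pos G.d_pos G.two_le_L m G.δ₁_pos).le
    have h3 : 0 ≤ A.cD ^ m := pow_nonneg (le_trans zero_le_one A.one_le_cD) _
    have h4 := A.toAmp.pref_nonneg
    positivity
  rw [A.toAmp.Etot_eq_sum_E, B3.display27 (B3.Assignment.bySort m A.k)]
  calc |∑ σ : Equiv.Perm (Fin m), ∑ j ∈ (B3.Assignment.bySort m A.k).J σ, A.E (fun l => ((j l : Fin A.k) : ℕ))|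
      ≤ ∑ σ : Equiv.Perm (Fin m), |∑ j ∈ (B3.Assignment.bySort m A.k).J σ, A.E (fun l => ((j l : Fin A.k) : ℕ))| :=
        abs_sum_le_sum_abs _ _
    _ ≤ ∑ σ : Equiv.Perm (Fin m), ∑ j ∈ (B3.Assignment.bySort m A.k).J σ, |A.E (fun l => ((j l : Fin A.k) : ℕ))| :=
        sum_le_sum fun σ _ => abs_sum_le_sum_abs _ _
    _ ≤ ∑ σ : Equiv.Perm (Fin m), (((m + 1) ^ m : ℕ) : ℝ) * B := by
        refine sum_le_sum fun σ _ => (A.sum_abs_E_le_ordering (B3.Assignment.bySort m A.k) σ (hyp σ)).trans ?_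
        exact mul_le_mul_of_nonneg_right (by exact_mod_cast card_choices_le _ _ _) hB0
    _ = (m.factorial : ℝ) * ((m + 1) ^ m : ℕ) * B := by
        rw [sum_const, card_univ, Fintype.card_perm, Fintype.card_fin, nsmul_eq_mul, mul_assoc]

end IBPAmp

end Literature.MathematicalPhysics.QuantumFieldTheory.Balaban1983to89.B3Ineq213
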